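import Summits.PneNP.PneNP.Theses.KarlinRubin
import Summits.PneNP.PneNP.Theorems.KarlinRubinMonotoneSufficesLocality

/-!
# Crux `MonotoneSuffices` (stmt-PneNP-18026), line `Sketch` (compression) — stub `stub_plantedMass`

The registered stub `stub_plantedMass` of the compression / polarization skeleton of the crux
`Summit.PneNP.PneNP.Theses.KarlinRubin.MonotoneSuffices`: for every clique size `k`, every test
`f : EdgeVec n → Bool` and every edge coordinate `e`, the down-up compression
`S_e f (x) = (f x[e←0] ∧ f x[e←1]) ∨ (x_e ∧ (f x[e←0] ∨ f x[e←1]))` has planted-law REJECTION mass at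
most that of `f` (type II never increases).

Proof. Fibre the planted law `plantedCliqueDist n k` over the planted set `S` (uniform on
`kSubsets n k`; given `S` the graph is `plant S x` with `x ∼ G(n,1/2)` uniform), exactly as in
`Summit.PneNP.PneNP.Theorems.plantedClique_errSum_locality`; it then suffices to compare, for each `S`,
the uniform masses of `{x | S_e f (plant S x) = false}` and `{x | f (plant S x) = false}`
(`plantedMass_fibre_le`).
* If both endpoints of `e` lie in `S`, then `plant S x e = true` and `(plant S x)[e←1] = plant S x`, so
  `S_e f (plant S x) = f (…[e←0]) ∨ f (plant S x) ≥ f (plant S x)`: the first set is contained in the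
  second.
* Otherwise planting commutes with updating the coordinate `e` and does not touch `x e`, so
  `S_e f ∘ plant S = S_e (f ∘ plant S)`; and for ANY `g` on the cube, `S_e g = g ∘ σ` for the involution
  `σ` that swaps the two points of an `e`-edge on which `g` is unsorted
  (`plantedMass_exists_involutive`), while the uniform law is invariant under a permutation
  (`plantedMass_uniform_preimage_equiv`); so the two masses are equal
  (`plantedMass_erdosRenyi_compress_false_eq`).
-/

set_option linter.dupNamespace false -- `Summit.PneNP.PneNP.…`: summit = sub-problem name (D-0017 single-conjunct layout)

namespace Summit.PneNP.PneNP.Theorems.MonotoneSuffices.Compression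

open Literature.Computability.Complexity Literature.Probability.RandomGraphs.PlantedClique Filter Finset
open Function (update)
open Summit.PneNP.PneNP.Theorems

/-- The uniform law on a finite type gives a set and its preimage under a permutation the same
mass. [folklore] -/
theorem plantedMass_uniform_preimage_equiv {α : Type*} [Fintype α] [Nonempty α] (σ : α ≃ α)
    (s : Set α) :
    (PMF.uniformOfFintype α).toOuterMeasure (σ ⁻¹' s) = (PMF.uniformOfFintype α).toOuterMeasure s := by
  classical
  rw [PMF.toOuterMeasure_apply, PMF.toOuterMeasure_apply]
  calc ∑' x, (σ ⁻¹' s).indicator (PMF.uniformOfFintype α) x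
      = ∑' x, s.indicator (PMF.uniformOfFintype α) (σ x) := tsum_congr fun x => by
        simp only [Set.indicator_apply, Set.mem_preimage, PMF.uniformOfFintype_apply]
    _ = ∑' y, s.indicator (PMF.uniformOfFintype α) y :=
        Equiv.tsum_eq σ (fun y => s.indicator (PMF.uniformOfFintype α) y)

/-- **Compression is composition with a sorting involution.** On the cube `ι → Bool`, for every `g`
and every coordinate `e` there is an involution `σ` (swap the two points `x[e←0], x[e←1]` of an
`e`-edge when `g x[e←0] = true` and `g x[e←1] = false`, fix all other points) with
`S_e g = g ∘ σ`. [folklore] -/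
theorem plantedMass_exists_involutive {ι : Type*} [DecidableEq ι] (e : ι) (g : (ι → Bool) → Bool) :
    ∃ σ : (ι → Bool) → (ι → Bool), Function.Involutive σ ∧
      ∀ x, ((g (update x e false) && g (update x e true)) ||
          (x e && (g (update x e false) || g (update x e true)))) = g (σ x) := by
  refine ⟨fun x => if g (update x e false) = true ∧ g (update x e true) = false
      then update x e (!x e) else x, fun x => ?_, fun x => ?_⟩
  · -- involutive: the swap condition only depends on the `e`-edge of `x`
    by_cases h : g (update x e false) = true ∧ g (update x e true) = false
    · simp only [h, and_self, if_true, Function.update_idem, Function.update_self, Bool.not_not,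
        Function.update_eq_self]
    · simp only [h, if_false]
  · have hxx : g x = g (update x e (x e)) := by rw [Function.update_eq_self]
    dsimp only
    split_ifs with h
    · obtain ⟨h0, h1⟩ := h
      rw [h0, h1]
      cases hx : x e
      · simpa using h1
      · simpa using h0
    · rw [hxx]
      cases x e <;> cases h0 : g (update x e false) <;> cases h1 : g (update x e true) <;> simp_all

/-- Under `G(n,1/2)` (uniform on the cube) the REJECTION mass of the compression `S_e g` equals that of
`g`: `S_e g = g ∘ σ` for a permutation `σ` of the cube, and the uniform law is `σ`-invariant.
[folklore] -/
theorem plantedMass_erdosRenyi_compress_false_eq {n : ℕ} (e : (⊤ : SimpleGraph (Fin n)).edgeSet)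
    (g : EdgeVec n → Bool) :
    (erdosRenyiHalf n).toOuterMeasure
        {x | ((g (update x e false) && g (update x e true)) ||
            (x e && (g (update x e false) || g (update x e true)))) = false} =
      (erdosRenyiHalf n).toOuterMeasure {x | g x = false} := by
  obtain ⟨σ, hσ, hg⟩ := plantedMass_exists_involutive e g
  have hset : {x : EdgeVec n | ((g (update x e false) && g (update x e true)) ||
      (x e && (g (update x e false) || g (update x e true)))) = false} =
      (hσ.toPerm σ) ⁻¹' {x | g x = false} := by
    ext x
    simp only [Set.mem_setOf_eq, Set.mem_preimage, hg, Function.Involutive.coe_toPerm]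
  rw [hset, erdosRenyiHalf, plantedMass_uniform_preimage_equiv]

/-- **The fibrewise comparison.** For a fixed planted set `S`, the `G(n,1/2)`-mass of
`{x | S_e f (plant S x) = false}` is at most that of `{x | f (plant S x) = false}`: if `e ⊆ S` then
`plant S x` is the top of its `e`-edge and `S_e f` takes the max there; otherwise `plant S` commutes
with `S_e` and `plantedMass_erdosRenyi_compress_false_eq` applies to `f ∘ plant S`. [folklore] -/
theorem plantedMass_fibre_le {n : ℕ} (S : Finset (Fin n)) (e : (⊤ : SimpleGraph (Fin n)).edgeSet)
    (f : EdgeVec n → Bool) :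
    (erdosRenyiHalf n).toOuterMeasure
        {x | ((f (update (plant S x) e false) && f (update (plant S x) e true)) ||
            (plant S x e && (f (update (plant S x) e false) || f (update (plant S x) e true)))) = false} ≤
      (erdosRenyiHalf n).toOuterMeasure {x | f (plant S x) = false} := by
  classical
  by_cases hin : ∀ v ∈ (e : Sym2 (Fin n)), v ∈ S
  · -- the edge lies inside the planted set: `plant S x` is the top of its `e`-edge
    refine MeasureTheory.measure_mono fun x hx => ?_
    simp only [Set.mem_setOf_eq] at hx ⊢
    have hpe : plant S x e = true := by
      simp only [plant, Bool.or_eq_true, decide_eq_true_eq]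
      exact Or.inr hin
    have hup : update (plant S x) e true = plant S x := by rw [Function.update_eq_self_iff, hpe]
    rw [hup, hpe] at hx
    revert hx
    cases f (update (plant S x) e false) <;> cases f (plant S x) <;> simp
  · -- the edge is not inside the planted set: planting commutes with the compression
    have hcomm : ∀ (x : EdgeVec n) (b : Bool), update (plant S x) e b = plant S (update x e b) := by
      intro x b
      funext e'
      rcases eq_or_ne e' e with rfl | h
      · rw [Function.update_self, plant_apply_of_not_inside S _ _ hin, Function.update_self]
      · rw [Function.update_of_ne h]
        simp only [plant, Function.update_of_ne h]
    have hxe : ∀ x : EdgeVec n, plant S x e = x e := fun x => plant_apply_of_not_inside S x e hin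
    have hset : {x : EdgeVec n | ((f (update (plant S x) e false) && f (update (plant S x) e true)) ||
        (plant S x e && (f (update (plant S x) e false) || f (update (plant S x) e true)))) = false} =
        {x | ((f (plant S (update x e false)) && f (plant S (update x e true))) ||
          (x e && (f (plant S (update x e false)) || f (plant S (update x e true))))) = false} := by
      ext x
      simp only [Set.mem_setOf_eq, hcomm, hxe]
    rw [hset]
    exact (plantedMass_erdosRenyi_compress_false_eq e (fun y => f (plant S y))).le

/-- **stub_plantedMass** (registered stub of line `Sketch` (compression), crux stmt-PneNP-18026; type II
never increases). For every `k`, every test `f` and every edge coordinate `e`, the planted-law mass of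
the REJECTION set of the compression `S_e f` is at most that of `f`: fibre `plantedCliqueDist n k`
over the planted set (`PMF.toOuterMeasure_bind_apply` / `_map_apply`) and compare fibrewise
(`plantedMass_fibre_le`). [folklore] -/
theorem stub_plantedMass :
    ∀ (n k : ℕ) (e : (⊤ : SimpleGraph (Fin n)).edgeSet) (f : EdgeVec n → Bool),
      (plantedCliqueDist n k).toOuterMeasure
          {x | ((f (update x e false) && f (update x e true)) ||
              (x e && (f (update x e false) || f (update x e true)))) = false} ≤
        (plantedCliqueDist n k).toOuterMeasure {x | f x = false} := by
  intro n k e f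
  rw [plantedCliqueDist, PMF.toOuterMeasure_map_apply, PMF.toOuterMeasure_map_apply, plantedCliqueJoint,
    PMF.toOuterMeasure_bind_apply, PMF.toOuterMeasure_bind_apply]
  refine ENNReal.tsum_le_tsum fun S => mul_le_mul_right ?_ _
  rw [PMF.toOuterMeasure_map_apply, PMF.toOuterMeasure_map_apply]
  exact plantedMass_fibre_le S e f

end Summit.PneNP.PneNP.Theorems.MonotoneSuffices.Compression
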